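import Literature.RingTheory.MvPolynomial.HomogeneousHilbertFunction
import Mathlib.LinearAlgebra.Matrix.NonsingularInverse
import Mathlib.LinearAlgebra.Matrix.Rank
import Mathlib.Algebra.Order.Antidiag.Finsupp
import Mathlib.Algebra.MvPolynomial.Eval
import HarnessLib

/-!
# Lower semicontinuity of `p ↦ dim_K I(p)_d` for polynomially parametrised homogeneous ideals

Let `K` be a field, `P` a set of parameters, `A = K[P]`, and let `g₁, …, g_s ∈ A[x_σ]` be forms
(homogeneous of degrees `e_j` in the `x`-variables) whose coefficients are polynomials in the parameters.
For a parameter value `p : P → K` write `g_j(p) ∈ K[x_σ]` for the specialisation and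
`I(p) = (g₁(p), …, g_s(p))`. Then for every degree `d` and every point `p₀` there is a polynomial
`δ ∈ K[P]` with `δ(p₀) ≠ 0` such that

  `δ(p) ≠ 0 ⟹ dim_K I(p₀)_d ≤ dim_K I(p)_d`

(`exists_eval_ne_zero_finrank_idealDegree_le`, and `…_finset` for finitely many degrees at once): the
Hilbert function of `K[x]/I(p)` can only DROP away from a proper Zariski-closed subset, i.e. the value
at any one point bounds the general value from above. MECHANISM (determinantal loci): `I(p)_d` is the
row space of the specialisation at `p` of ONE matrix `M_d` over `A` (rows: the products `x^m · g_j`,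
`|m| + e_j = d`, written in the monomial basis); "a matrix with coefficients in a field has rank `≤ r` if
and only if all its `(r+1)`-minors vanish", so `{A ; rk A ≤ r} = V(I_{r+1}(A_univ))` is Zariski-closed
[cite: GortzWedhorn2020, (16.1), eq. (16.1.1) and Def. 16.5 / Prop. 16.6], and "the formation of the
ideals of minors `I_t(φ)` commutes with ring extensions" [cite: BrunsHerzog1998, §1.4, Lemma 1.4.8 and
the remark before it]; so a `t`-minor of `M_d` that is non-zero at `p₀` (`t = dim I(p₀)_d`) is the
required `δ`.

Lean route (theorem-only file): `exists_submatrix_isUnit_of_linearIndependent_rows` (independent rows of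
a matrix over a field admit an invertible maximal column-submatrix — row rank = column rank, Mathlib
`Matrix.rank_transpose`); `exists_eval_ne_zero_linearIndependent_map` (a family of universal polynomials
whose specialisation at `p₀` is linearly independent stays independent wherever that minor of the
universal coefficient matrix is non-zero); `exists_eval_ne_zero_finrank_span_le` (dimension of the span
version); `idealDegree_span_eq_span_monomial_mul` (`I_d` is the `K`-span of the `x^m g_j`, `|m| + e_j = d`,
for homogeneous generators); and the two ideal-level statements. Used by
`AlgebraicGeometry/Kloosterman2025/LinearSectionGeneralFibres` to turn ONE rational instance of an
Artinian reduction into the general-fibre statement of [Kloosterman2025, Prop. 6.4].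

## References

* [GortzWedhorn2020] U. Görtz, T. Wedhorn, *Algebraic Geometry I: Schemes*, 2nd ed., Springer (2020),
  Chapter 16, (16.1) "Determinantal varieties", eq. (16.1.1); (16.3) Def. 16.5, Prop. 16.6.
* [BrunsHerzog1998] W. Bruns, J. Herzog, *Cohen–Macaulay rings*, rev. ed., Cambridge Stud. Adv. Math.
  39 (1998), §1.4 "Ideals of minors and Fitting invariants", Lemma 1.4.8 (pp. 21–22).
-/

noncomputable section

open MvPolynomial Module

namespace Literature.RingTheory.MvPolynomial

variable {K : Type*} [Field K]

/-! ## Independent rows have an invertible maximal column-submatrix -/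

/-- Over a field, a matrix with linearly independent rows has an invertible square submatrix on ALL
rows and suitably chosen columns (row rank = column rank; "a matrix with coefficients in a field has
rank `≤ r` if and only if all its `(r+1)`-minors vanish"). [cite: GortzWedhorn2020, (16.1), eq. (16.1.1)]
[cite: BrunsHerzog1998, Lemma 1.4.8] -/
theorem exists_submatrix_isUnit_of_linearIndependent_rows {ρ U : Type*} [Fintype ρ] [DecidableEq ρ]
    [Fintype U] (M : Matrix ρ U K) (h : LinearIndependent K M.row) :
    ∃ f : ρ → U, IsUnit (M.submatrix id f) := by
  classical
  obtain ⟨κ, a, ha, hspan, hli⟩ := exists_linearIndependent' K M.col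
  haveI : Finite κ := Finite.of_injective a ha
  letI : Fintype κ := Fintype.ofFinite κ
  have h1 : M.rank = Fintype.card ρ := by
    rw [Matrix.rank_eq_finrank_span_row]
    exact finrank_span_eq_card h
  have h2 : M.rank = Fintype.card κ := by
    rw [Matrix.rank_eq_finrank_span_cols, ← hspan]
    exact finrank_span_eq_card hli
  let e : ρ ≃ κ := Fintype.equivOfCardEq (h1.symm.trans h2)
  refine ⟨a ∘ e, ?_⟩
  rw [← Matrix.linearIndependent_cols_iff_isUnit]
  have hcol : (M.submatrix id (a ∘ e)).col = (M.col ∘ a) ∘ e := by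
    funext j i
    rfl
  rw [hcol]
  exact hli.comp e e.injective

/-! ## Universal families of polynomials: independence is an open condition -/

variable {P σ : Type*}

/-- The coefficients of a specialisation are the specialised coefficients, so a specialised universal
polynomial is supported on the support of the universal one. [folklore] -/
private theorem coeff_map_eval_eq_zero_of_notMem_support (p : P → K) (r : MvPolynomial σ (MvPolynomial P K))
    {m : σ →₀ ℕ} (hm : m ∉ r.support) : coeff m (MvPolynomial.map (eval p) r) = 0 := by
  rw [coeff_map, notMem_support_iff.mp hm, map_zero]

/-- **Linear independence of specialisations is an open condition, witnessed by one minor.** Let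
`r_i ∈ K[P][x_σ]` be finitely many universal polynomials and `p₀ : P → K` a parameter value at which the
specialisations `r_i(p₀) ∈ K[x_σ]` are linearly independent over `K`. Then some polynomial `δ ∈ K[P]`
(a maximal minor of the universal coefficient matrix) satisfies `δ(p₀) ≠ 0`, and the `r_i(p)` are
linearly independent at every `p` with `δ(p) ≠ 0` (the open stratum `rk = t` of the determinantal
locus, pulled back along the classifying map of the coefficient matrix).
[cite: GortzWedhorn2020, (16.1), eq. (16.1.1); (16.3), Def. 16.5, Prop. 16.6]
[cite: BrunsHerzog1998, §1.4, Lemma 1.4.8 ("the formation of `I_t(φ)` commutes with ring extensions")] -/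
theorem exists_eval_ne_zero_linearIndependent_map {ρ : Type*} [Finite ρ]
    (r : ρ → MvPolynomial σ (MvPolynomial P K)) (p₀ : P → K)
    (h : LinearIndependent K fun i => MvPolynomial.map (eval p₀) (r i)) :
    ∃ δ : MvPolynomial P K, eval p₀ δ ≠ 0 ∧
      ∀ p : P → K, eval p δ ≠ 0 → LinearIndependent K fun i => MvPolynomial.map (eval p) (r i) := by
  classical
  cases nonempty_fintype ρ
  -- the finitely many `x`-monomials occurring in the universal polynomials
  let U : Finset (σ →₀ ℕ) := Finset.univ.biUnion fun i => (r i).support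
  have hU : ∀ (p : P → K) (i : ρ) (m : σ →₀ ℕ), m ∉ U →
      coeff m (MvPolynomial.map (eval p) (r i)) = 0 := fun p i m hm =>
    coeff_map_eval_eq_zero_of_notMem_support p (r i) fun h' =>
      hm (Finset.mem_biUnion.mpr ⟨i, Finset.mem_univ _, h'⟩)
  -- the universal coefficient matrix and its specialisations
  let Mu : Matrix ρ U (MvPolynomial P K) := fun i m => coeff (m : σ →₀ ℕ) (r i)
  let M : (P → K) → Matrix ρ U K := fun p i m => coeff (m : σ →₀ ℕ) (MvPolynomial.map (eval p) (r i))
  have hM : ∀ p, Mu.map (eval p) = M p := by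
    intro p
    ext i m
    simp [M, Mu, coeff_map]
  -- the coefficient-vector map on `U`
  let cd : MvPolynomial σ K →ₗ[K] (U → K) :=
    LinearMap.pi fun m : U => lcoeff K (m : σ →₀ ℕ)
  have hcd : ∀ p, (M p).row = cd ∘ fun i => MvPolynomial.map (eval p) (r i) := by
    intro p
    funext i m
    simp [M, cd, Matrix.row]
  -- elements of the span of the specialised family are supported on `U`
  have hspanU : ∀ (p : P → K) (q : MvPolynomial σ K),
      q ∈ Submodule.span K (Set.range fun i => MvPolynomial.map (eval p) (r i)) →
      ∀ m : σ →₀ ℕ, m ∉ U → coeff m q = 0 := by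
    intro p q hq m hm
    induction hq using Submodule.span_induction with
    | mem x hx =>
      obtain ⟨i, rfl⟩ := hx
      exact hU p i m hm
    | zero => exact coeff_zero m
    | add x y _ _ hx hy => rw [coeff_add, hx, hy, add_zero]
    | smul a x _ hx => rw [coeff_smul, hx, smul_zero]
  -- Step 1: the rows of `M p₀` are linearly independent
  have h0 : LinearIndependent K (M p₀).row := by
    rw [hcd p₀]
    refine h.map_injOn cd fun x hx y hy hxy => ?_
    ext m
    by_cases hm : m ∈ U
    · have := congrFun hxy ⟨m, hm⟩
      simpa [cd] using this
    · rw [hspanU p₀ x hx m hm, hspanU p₀ y hy m hm]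
  -- Step 2: an invertible maximal minor at `p₀`; its universal version is `δ`
  obtain ⟨f, hf⟩ := exists_submatrix_isUnit_of_linearIndependent_rows (M p₀) h0
  refine ⟨(Mu.submatrix id f).det, ?_, fun p hp => ?_⟩
  · rw [RingHom.map_det, RingHom.mapMatrix_apply, ← Matrix.submatrix_map, hM p₀]
    exact ((Matrix.isUnit_iff_isUnit_det _).mp hf).ne_zero
  · rw [RingHom.map_det, RingHom.mapMatrix_apply, ← Matrix.submatrix_map, hM p] at hp
    have hunit : IsUnit ((M p).submatrix id f) :=
      (Matrix.isUnit_iff_isUnit_det _).mpr (isUnit_iff_ne_zero.mpr hp)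
    have hrows : LinearIndependent K ((M p).submatrix id f).row :=
      Matrix.linearIndependent_rows_iff_isUnit.mpr hunit
    -- rows of the submatrix are the rows of `M p` composed with the column selection
    have hsub : ((M p).submatrix id f).row = LinearMap.funLeft K K f ∘ (M p).row := by
      funext i j
      rfl
    rw [hsub] at hrows
    have hMp : LinearIndependent K (M p).row := LinearIndependent.of_comp _ hrows
    rw [hcd p] at hMp
    exact LinearIndependent.of_comp _ hMp

/-- **The dimension of the span of specialisations is lower semicontinuous, witnessed by one minor**:
for universal polynomials `r_i ∈ K[P][x_σ]` and a point `p₀` there is `δ ∈ K[P]` with `δ(p₀) ≠ 0` and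
`dim_K ⟨r_i(p₀)⟩ ≤ dim_K ⟨r_i(p)⟩` whenever `δ(p) ≠ 0` (lower semicontinuity of the rank of the
specialised coefficient matrix). [cite: GortzWedhorn2020, (16.1), eq. (16.1.1)]
[cite: BrunsHerzog1998, §1.4, Lemma 1.4.8] -/
theorem exists_eval_ne_zero_finrank_span_le {ρ : Type*} [Finite ρ]
    (r : ρ → MvPolynomial σ (MvPolynomial P K)) (p₀ : P → K) :
    ∃ δ : MvPolynomial P K, eval p₀ δ ≠ 0 ∧ ∀ p : P → K, eval p δ ≠ 0 →
      finrank K (Submodule.span K (Set.range fun i => MvPolynomial.map (eval p₀) (r i))) ≤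
        finrank K (Submodule.span K (Set.range fun i => MvPolynomial.map (eval p) (r i))) := by
  classical
  obtain ⟨κ, a, ha, hspan, hli⟩ :=
    exists_linearIndependent' K (fun i => MvPolynomial.map (eval p₀) (r i))
  haveI : Finite κ := Finite.of_injective a ha
  cases nonempty_fintype κ
  obtain ⟨δ, h₀, hδ⟩ := exists_eval_ne_zero_linearIndependent_map (r ∘ a) p₀ hli
  refine ⟨δ, h₀, fun p hp => ?_⟩
  have hlip := hδ p hp
  haveI : Module.Finite K
      (Submodule.span K (Set.range fun i => MvPolynomial.map (eval p) (r i))) :=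
    Module.Finite.span_of_finite K (Set.finite_range _)
  calc finrank K (Submodule.span K (Set.range fun i => MvPolynomial.map (eval p₀) (r i)))
      = finrank K (Submodule.span K
          (Set.range ((fun i => MvPolynomial.map (eval p₀) (r i)) ∘ a))) := by rw [hspan]
    _ = Fintype.card κ := finrank_span_eq_card hli
    _ = finrank K (Submodule.span K
          (Set.range fun j => MvPolynomial.map (eval p) ((r ∘ a) j))) :=
        (finrank_span_eq_card hlip).symm
    _ ≤ finrank K (Submodule.span K (Set.range fun i => MvPolynomial.map (eval p) (r i))) :=
        Submodule.finrank_mono (Submodule.span_mono (by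
          rintro _ ⟨j, rfl⟩
          exact ⟨a j, rfl⟩))

/-! ## The degree-`d` part of an ideal with homogeneous generators -/

/-- Below the degree of a form the homogeneous components of its multiples vanish. [folklore] -/
private theorem homogeneousComponent_mul_eq_zero_of_lt' {R : Type*} [CommSemiring R]
    {φ : MvPolynomial σ R} {e μ : ℕ} (hφ : φ.IsHomogeneous e) (hμ : μ < e) (h : MvPolynomial σ R) :
    homogeneousComponent μ (h * φ) = 0 := by
  classical
  rw [← sum_homogeneousComponent h, Finset.sum_mul, map_sum]
  refine Finset.sum_eq_zero fun i _ => ?_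
  have hi : (homogeneousComponent i h * φ).IsHomogeneous (i + e) :=
    (homogeneousComponent_isHomogeneous i h).mul hφ
  rw [homogeneousComponent_of_mem hi, if_neg (by omega)]

/-- Specialisation preserves homogeneity. [folklore] -/
private theorem isHomogeneous_map_eval {g : MvPolynomial σ (MvPolynomial P K)} {e : ℕ}
    (hg : g.IsHomogeneous e) (p : P → K) : (MvPolynomial.map (eval p) g).IsHomogeneous e :=
  hg.map _

variable [Fintype σ] [DecidableEq σ]

/-- Exponent vectors in the antidiagonal `Finset.univ.finsuppAntidiag t` are exactly those of degree `t`.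
[folklore] -/
private theorem mem_finsuppAntidiag_univ_iff_degree {t : ℕ} {m : σ →₀ ℕ} :
    m ∈ (Finset.univ : Finset σ).finsuppAntidiag t ↔ m.degree = t := by
  rw [Finset.mem_finsuppAntidiag', Finsupp.degree_apply]
  simp [Finsupp.sum]

/-- **`I_d` for homogeneous generators**: if `I = (φ_j)` with `φ_j` homogeneous of degree `e_j`, then the
forms of degree `d` in `I` are exactly the `K`-linear combinations of the products `x^m · φ_j` with
`|m| + e_j = d` ("every form of degree `μ` in `⟨φ⟩` is `Σ_{d_j ≤ μ} (h_j)_{μ - d_j} φ_j`"; the family is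
indexed by all `j` and all `m` of degree `d − e_j`, the entries with `e_j > d` being set to `0`).
[cite: CossartJannsenSaito2020, Lemma 2.2 (proof)] -/
theorem idealDegree_span_eq_span_monomial_mul {ι : Type*} [Fintype ι] (φ : ι → MvPolynomial σ K)
    (e : ι → ℕ) (hφ : ∀ j, (φ j).IsHomogeneous (e j)) (d : ℕ) :
    idealDegree (Ideal.span (Set.range φ)) d =
      Submodule.span K (Set.range fun q :
          (Σ j : ι, ↥((Finset.univ : Finset σ).finsuppAntidiag (d - e j))) =>
        if e q.1 ≤ d then monomial (q.2 : σ →₀ ℕ) (1 : K) * φ q.1 else 0) := by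
  classical
  refine le_antisymm ?_ (Submodule.span_le.mpr ?_)
  · -- `⊆`: write `f = Σ c_j φ_j`, take degree-`d` components, expand `(c_j)_{d - e_j}` in monomials
    intro f hf
    obtain ⟨hfI, hfd⟩ := hf
    obtain ⟨c, hc⟩ := Ideal.mem_span_range_iff_exists_fun.mp hfI
    rw [← homogeneousComponent_eq_self hfd, ← hc, map_sum]
    refine Submodule.sum_mem _ fun j _ => ?_
    by_cases hj : e j ≤ d
    · obtain ⟨t, ht⟩ := Nat.exists_eq_add_of_le' hj
      -- `(c_j φ_j)_d = φ_j (c_j)_t`, `t = d - e_j`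
      have hcomp : homogeneousComponent d (c j * φ j) = φ j * homogeneousComponent t (c j) := by
        rw [ht, mul_comm]
        exact homogeneousComponent_mul_add_of_isHomogeneous (hφ j) (c j) t
      rw [hcomp, homogeneousComponent_apply, Finset.mul_sum]
      refine Submodule.sum_mem _ fun m hm => ?_
      rw [Finset.mem_filter] at hm
      have hmt : m ∈ (Finset.univ : Finset σ).finsuppAntidiag (d - e j) := by
        rw [mem_finsuppAntidiag_univ_iff_degree, hm.2]
        omega
      have hmono : φ j * monomial m (coeff m (c j)) =
          coeff m (c j) • (monomial m (1 : K) * φ j) := by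
        rw [smul_eq_C_mul, ← mul_assoc, C_mul_monomial, mul_one, mul_comm]
      rw [hmono]
      refine Submodule.smul_mem _ _ (Submodule.subset_span ⟨⟨j, ⟨m, hmt⟩⟩, ?_⟩)
      simp [hj]
    · rw [homogeneousComponent_mul_eq_zero_of_lt' (hφ j) (not_le.mp hj)]
      exact zero_mem _
  · -- `⊇`: each product lies in `I` and is a form of degree `d`
    rintro _ ⟨⟨j, m, hm⟩, rfl⟩
    by_cases hj : e j ≤ d
    · simp only [hj, if_true]
      refine ⟨Ideal.mul_mem_left _ _ (Ideal.subset_span ⟨j, rfl⟩), ?_⟩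
      have hdeg : (m : σ →₀ ℕ).degree = d - e j := mem_finsuppAntidiag_univ_iff_degree.mp hm
      have h := (isHomogeneous_monomial (1 : K) hdeg).mul (hφ j)
      rwa [Nat.sub_add_cancel hj] at h
    · simp only [hj, if_false]
      exact zero_mem _

/-! ## Semicontinuity of `dim_K I(p)_d` -/

/-- **Lower semicontinuity of the Hilbert function of the ideal, one degree.** Let
`g_j ∈ K[P][x_σ]` be forms of degrees `e_j` in `x` with polynomial coefficients in the parameters `P`,
and `I(p) = (g_j(p))_j ⊆ K[x_σ]` the specialised ideal at `p : P → K`. For every `d` and `p₀` there is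
`δ ∈ K[P]` with `δ(p₀) ≠ 0` such that `dim_K I(p₀)_d ≤ dim_K I(p)_d` whenever `δ(p) ≠ 0` — the rank of
the specialised coefficient matrix is generically at least its value at `p₀`, witnessed by one minor
("a matrix with coefficients in a field has rank `≤ r` iff all its `(r+1)`-minors vanish",
`Δ^r = V(I_{r+1}(A_univ))`, and the formation of ideals of minors commutes with base change).
[cite: GortzWedhorn2020, (16.1), eq. (16.1.1); (16.3), eq. (16.3.1), Def. 16.5, Prop. 16.6]
[cite: BrunsHerzog1998, §1.4, Lemma 1.4.8] -/
theorem exists_eval_ne_zero_finrank_idealDegree_le {ι : Type*} [Finite ι]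
    (g : ι → MvPolynomial σ (MvPolynomial P K)) (e : ι → ℕ) (hg : ∀ j, (g j).IsHomogeneous (e j))
    (p₀ : P → K) (d : ℕ) :
    ∃ δ : MvPolynomial P K, eval p₀ δ ≠ 0 ∧ ∀ p : P → K, eval p δ ≠ 0 →
      finrank K (idealDegree (Ideal.span (Set.range fun j => MvPolynomial.map (eval p₀) (g j))) d) ≤
        finrank K (idealDegree (Ideal.span (Set.range fun j => MvPolynomial.map (eval p) (g j))) d) := by
  classical
  cases nonempty_fintype ι
  -- universal rows `x^m g_j`, `|m| + e_j = d`
  let r : (Σ j : ι, ↥((Finset.univ : Finset σ).finsuppAntidiag (d - e j))) →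
      MvPolynomial σ (MvPolynomial P K) :=
    fun q => if e q.1 ≤ d then monomial (q.2 : σ →₀ ℕ) 1 * g q.1 else 0
  have hr : ∀ p : P → K, (fun q => MvPolynomial.map (eval p) (r q)) = fun q :
      (Σ j : ι, ↥((Finset.univ : Finset σ).finsuppAntidiag (d - e j))) =>
      if e q.1 ≤ d then monomial (q.2 : σ →₀ ℕ) (1 : K) * MvPolynomial.map (eval p) (g q.1) else 0 := by
    intro p
    funext q
    by_cases hq : e q.1 ≤ d
    · simp [r, hq, map_monomial]
    · simp [r, hq]
  have hspan : ∀ p : P → K,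
      idealDegree (Ideal.span (Set.range fun j => MvPolynomial.map (eval p) (g j))) d =
        Submodule.span K (Set.range fun q => MvPolynomial.map (eval p) (r q)) := by
    intro p
    rw [hr p]
    exact idealDegree_span_eq_span_monomial_mul _ e (fun j => isHomogeneous_map_eval (hg j) p) d
  obtain ⟨δ, h₀, hδ⟩ := exists_eval_ne_zero_finrank_span_le r p₀
  refine ⟨δ, h₀, fun p hp => ?_⟩
  rw [hspan p₀, hspan p]
  exact hδ p hp

/-- **Lower semicontinuity of the Hilbert function of the ideal, finitely many degrees**: one `δ` with
`δ(p₀) ≠ 0` controlling all degrees `d ∈ D` at once (the product of the minors).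
[cite: GortzWedhorn2020, (16.1), eq. (16.1.1)] [cite: BrunsHerzog1998, §1.4, Lemma 1.4.8] -/
theorem exists_eval_ne_zero_finrank_idealDegree_le_finset {ι : Type*} [Finite ι]
    (g : ι → MvPolynomial σ (MvPolynomial P K)) (e : ι → ℕ) (hg : ∀ j, (g j).IsHomogeneous (e j))
    (p₀ : P → K) (D : Finset ℕ) :
    ∃ δ : MvPolynomial P K, eval p₀ δ ≠ 0 ∧ ∀ p : P → K, eval p δ ≠ 0 → ∀ d ∈ D,
      finrank K (idealDegree (Ideal.span (Set.range fun j => MvPolynomial.map (eval p₀) (g j))) d) ≤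
        finrank K (idealDegree (Ideal.span (Set.range fun j => MvPolynomial.map (eval p) (g j))) d) := by
  classical
  induction D using Finset.induction_on with
  | empty => exact ⟨1, by simp, fun p _ d hd => absurd hd (Finset.notMem_empty d)⟩
  | insert d D hdD ih =>
    obtain ⟨δ₁, h₁, hδ₁⟩ := exists_eval_ne_zero_finrank_idealDegree_le g e hg p₀ d
    obtain ⟨δ₂, h₂, hδ₂⟩ := ih
    refine ⟨δ₁ * δ₂, by rw [map_mul]; exact mul_ne_zero h₁ h₂, fun p hp d' hd' => ?_⟩
    rw [map_mul] at hp
    rcases Finset.mem_insert.mp hd' with rfl | hd'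
    · exact hδ₁ p (left_ne_zero_of_mul hp)
    · exact hδ₂ p (right_ne_zero_of_mul hp) d' hd'

end Literature.RingTheory.MvPolynomial
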